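import Summits.QuantumFields.YangMills.Theorems.SoloBlindRatioFromCovariance
import Summits.QuantumFields.YangMills.Theorems.SoloBlindAxisResolvent
import HarnessLib

/-!
# SoloBlind — D17: the lattice Maxwell plaquette covariance is not exponentially small

Soloist seat `solo-QuantumFields-blind` (session s23).  Rung D17 of the seat's infrared-zero
chain.  `SoloBlindRatioFromCovariance` (D13) reduced the analytic input of IR-0 for the Wilson
plaquette field of a compact simple `G` to the Theorem-A-shaped limit statement
`HasScaledCovarianceLimit r P s K` plus two properties of the limit covariances `K`
(`K 0 > 0`, `∀ m₀ > 0, ∃ n, e^{-m₀ n} K 0 < K n`), which Appendix A of the seat's paper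
`paper/local-gaussianity.md` supplies in prose: `K n` is a positive multiple of the SQUARED
plaquette two-point function of free lattice Maxwell theory at separation `n` along a lattice
axis, which decays like `n^{-2d}`, not exponentially.  This file discharges those properties
IN THE KERNEL for the explicit lattice Maxwell covariance, with no asymptotic analysis.

For a plaquette with directions in `D ⊆ {spatial directions}` (`m` spatial directions,
`d = m + 1`) and separation `n` along the time axis, free lattice Maxwell theory gives
`κ(n) = (2π)^{-(m+1)} ∫_{[-π,π]^m} dθ ∫_{-π}^{π} dt N_D(θ) cos(n t) / (E(θ) + ŝ(t))` with
`ŝ(t) = 2 - 2 cos t`, `E(θ) = ∑_j ŝ(θ_j)`, `N_D(θ) = ∑_{j ∈ D} ŝ(θ_j)` (`maxwellCov m D n`).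
By the closed form of the one-dimensional resolvent (`SoloBlindAxisResolvent`, D17a) the
inner integral is `N_D(θ) π r(a)ⁿ / √(a² - 1)`, `a = 1 + E(θ)/2`, `r(a) = a - √(a² - 1)`
(`axisCov_eq`): a transfer-matrix representation of `κ` as a POSITIVE MIXTURE OF DECAYING
EXPONENTIALS whose rates `-log r(a(θ)) → 0` as `θ → 0` — the lattice photon is massless.
Restricting to a small momentum box gives `∀ ε > 0, ∃ c > 0, ∀ n, c e^{-ε n} ≤ κ(n)`
(`exists_exp_mul_le_maxwellCov`; in particular `κ(n) > 0`), hence `K n := C κ(n)²`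
satisfies the D13 hypothesis for every `C > 0` (`exists_exp_mul_maxwellCov_sq_lt`), and
`correlationLengthDiverges_wilsonPlaquette_of_maxwellCovarianceLimit` states IR-0 for the
Wilson plaquette field with the single remaining hypothesis
`HasScaledCovarianceLimit r P s (fun n => C * maxwellCov m D n ^ 2)`, `s` eventually positive —
the content of Theorem A of the paper (`s β = β²`, `m = 3`, `D` the plaquette's two spatial
directions, `C = N²/2`).  No claim is made about Theorem A itself, and nothing here bears on
the infrared wall IR-1 of the seat's obstruction paper.
-/

open Real MeasureTheory Set Filter Topology intervalIntegral
open Literature.MathematicalPhysics.QuantumFieldTheory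
open Literature.MathematicalPhysics.QuantumLattice

noncomputable section

namespace Summit.QuantumFields.YangMills.Theorems.SoloBlind

/-! ### The lattice dispersion -/

/-- The one-dimensional lattice dispersion `ŝ(t) = 2 - 2 cos t = |e^{it} - 1|²`. -/
def sHat (t : ℝ) : ℝ := 2 - 2 * Real.cos t

/-- `0 ≤ ŝ(t)`. -/
theorem sHat_nonneg (t : ℝ) : 0 ≤ sHat t := by
  unfold sHat; linarith [Real.cos_le_one t]

/-- `ŝ(0) = 0`. -/
theorem sHat_zero : sHat 0 = 0 := by simp [sHat]

/-- `ŝ` is continuous. -/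
@[fun_prop]
theorem continuous_sHat : Continuous sHat := by
  unfold sHat; fun_prop

/-- `ŝ` is non-decreasing on `[0, π]`. -/
theorem sHat_mono {t u : ℝ} (ht : 0 ≤ t) (htu : t ≤ u) (hu : u ≤ π) : sHat t ≤ sHat u := by
  unfold sHat; linarith [Real.cos_le_cos_of_nonneg_of_le_pi ht hu htu]

/-- `ŝ(t) > 0` for `0 < t ≤ π`. -/
theorem sHat_pos {t : ℝ} (ht : 0 < t) (htπ : t ≤ π) : 0 < sHat t := by
  unfold sHat
  have hne : Real.cos t ≠ 1 := by
    intro h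
    have := (Real.cos_eq_one_iff_of_lt_of_lt (by linarith [pi_pos]) (by linarith [pi_pos])).1 h
    linarith
  have hlt : Real.cos t < 1 := lt_of_le_of_ne (Real.cos_le_one t) hne
  linarith

variable {m : ℕ}

/-- The spatial lattice energy `E(θ) = ∑_j ŝ(θ_j)` of a spatial momentum `θ ∈ ℝ^m`. -/
def energy (θ : Fin m → ℝ) : ℝ := ∑ j, sHat (θ j)

/-- The plaquette numerator `N_D(θ) = ∑_{j ∈ D} ŝ(θ_j)` (Fourier multiplier of the squared
field strength of a plaquette with directions in `D`, at zero momentum along the separation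
axis, in Feynman gauge). -/
def plaqNum (D : Finset (Fin m)) (θ : Fin m → ℝ) : ℝ := ∑ j ∈ D, sHat (θ j)

/-- The transfer-matrix parameter `a(θ) = 1 + E(θ)/2` (`= cosh` of the decay rate). -/
def coshRate (θ : Fin m → ℝ) : ℝ := 1 + energy θ / 2

/-- `0 ≤ E(θ)`. -/
theorem energy_nonneg (θ : Fin m → ℝ) : 0 ≤ energy θ :=
  Finset.sum_nonneg fun j _ => sHat_nonneg (θ j)

/-- `0 ≤ N_D(θ)`. -/
theorem plaqNum_nonneg (D : Finset (Fin m)) (θ : Fin m → ℝ) : 0 ≤ plaqNum D θ :=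
  Finset.sum_nonneg fun j _ => sHat_nonneg (θ j)

/-- `N_D(θ) ≤ E(θ)`. -/
theorem plaqNum_le_energy (D : Finset (Fin m)) (θ : Fin m → ℝ) : plaqNum D θ ≤ energy θ :=
  Finset.sum_le_sum_of_subset_of_nonneg (Finset.subset_univ D) fun j _ _ => sHat_nonneg (θ j)

/-- `1 ≤ a(θ)`. -/
theorem one_le_coshRate (θ : Fin m → ℝ) : 1 ≤ coshRate θ := by
  unfold coshRate; linarith [energy_nonneg θ]

/-- `N_D` is continuous. -/
@[fun_prop]
theorem continuous_plaqNum (D : Finset (Fin m)) : Continuous (plaqNum D) := by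
  unfold plaqNum; fun_prop

/-! ### The covariance along the separation axis at fixed spatial momentum -/

/-- `axisCov D n θ = ∫_{-π}^{π} N_D(θ) cos(n t) / (E(θ) + ŝ(t)) dt`: the momentum integral
along the separation axis at fixed spatial momentum `θ`. -/
def axisCov (D : Finset (Fin m)) (n : ℕ) (θ : Fin m → ℝ) : ℝ :=
  ∫ t in (-π)..π, plaqNum D θ * Real.cos ((n : ℝ) * t) / (energy θ + sHat t)

/-- **Transfer-matrix form.**  `axisCov D n θ = N_D(θ) · π r(a)ⁿ / √(a² - 1)` with
`a = 1 + E(θ)/2` (`SoloBlindAxisResolvent.axisResolvent_eq`); at `E(θ) = 0` both sides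
vanish (`N_D ≤ E`). -/
theorem axisCov_eq (D : Finset (Fin m)) (n : ℕ) (θ : Fin m → ℝ) :
    axisCov D n θ = plaqNum D θ * axisKernel n (coshRate θ) := by
  unfold axisCov
  rcases (energy_nonneg θ).eq_or_lt with h | h
  · have hN : plaqNum D θ = 0 :=
      le_antisymm (h ▸ plaqNum_le_energy D θ) (plaqNum_nonneg D θ)
    simp [hN]
  · have ha : 1 < coshRate θ := by unfold coshRate; linarith
    have hint : (fun t => plaqNum D θ * Real.cos ((n : ℝ) * t) / (energy θ + sHat t)) =
        fun t => plaqNum D θ / 2 * (Real.cos ((n : ℝ) * t) / (coshRate θ - Real.cos t)) := by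
      funext t
      have hd : coshRate θ - Real.cos t ≠ 0 :=
        (show 0 < coshRate θ - Real.cos t by linarith [Real.cos_le_one t]).ne'
      have hden : energy θ + sHat t = 2 * (coshRate θ - Real.cos t) := by
        unfold coshRate sHat; ring
      rw [hden]
      field_simp
    have hR := axisResolvent_eq_two_mul_axisKernel ha n
    unfold axisResolvent at hR
    rw [hint, intervalIntegral.integral_const_mul, hR]
    ring

/-- `0 ≤ axisCov D n θ`. -/
theorem axisCov_nonneg (D : Finset (Fin m)) (n : ℕ) (θ : Fin m → ℝ) : 0 ≤ axisCov D n θ := by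
  rw [axisCov_eq]
  exact mul_nonneg (plaqNum_nonneg D θ) (axisKernel_nonneg n (one_le_coshRate θ))

/-- `E(θ) · axisKernel n (a(θ)) ≤ 2π` (`E ≤ 2 √(a² - 1)` and `r ≤ 1`). -/
theorem energy_mul_axisKernel_le (n : ℕ) (θ : Fin m → ℝ) :
    energy θ * axisKernel n (coshRate θ) ≤ 2 * π := by
  have hE0 : 0 ≤ energy θ := energy_nonneg θ
  have ha1 : 1 ≤ coshRate θ := one_le_coshRate θ
  have hsq : coshRate θ ^ 2 - 1 = energy θ + energy θ ^ 2 / 4 := by unfold coshRate; ring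
  unfold axisKernel
  rw [hsq]
  rcases hE0.eq_or_lt with h | h
  · rw [← h]; simp [pi_pos.le]
  · have hs : 0 < Real.sqrt (energy θ + energy θ ^ 2 / 4) := Real.sqrt_pos.2 (by positivity)
    have hr1 : decayRatio (coshRate θ) ^ n ≤ 1 :=
      pow_le_one₀ (decayRatio_pos ha1).le (decayRatio_le_one ha1)
    have hr0 : 0 ≤ decayRatio (coshRate θ) ^ n := pow_nonneg (decayRatio_pos ha1).le n
    have hEs : energy θ / 2 ≤ Real.sqrt (energy θ + energy θ ^ 2 / 4) :=
      Real.le_sqrt_of_sq_le (by nlinarith)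
    calc energy θ * (π * decayRatio (coshRate θ) ^ n / Real.sqrt (energy θ + energy θ ^ 2 / 4))
        = energy θ / Real.sqrt (energy θ + energy θ ^ 2 / 4) *
            (π * decayRatio (coshRate θ) ^ n) := by ring
      _ ≤ 2 * (π * 1) := by
          apply mul_le_mul _ (mul_le_mul_of_nonneg_left hr1 pi_pos.le) (by positivity)
            (by norm_num)
          rw [div_le_iff₀ hs]; linarith
      _ = 2 * π := by ring

/-- `axisCov D n θ ≤ 2π`. -/
theorem axisCov_le_two_pi (D : Finset (Fin m)) (n : ℕ) (θ : Fin m → ℝ) :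
    axisCov D n θ ≤ 2 * π := by
  rw [axisCov_eq]
  exact (mul_le_mul_of_nonneg_right (plaqNum_le_energy D θ)
    (axisKernel_nonneg n (one_le_coshRate θ))).trans (energy_mul_axisKernel_le n θ)

/-- `θ ↦ axisCov D n θ` is measurable (via the transfer-matrix form). -/
theorem measurable_axisCov (D : Finset (Fin m)) (n : ℕ) : Measurable (axisCov D n) := by
  have h : axisCov D n = fun θ => plaqNum D θ *
      (π * decayRatio (coshRate θ) ^ n / Real.sqrt (coshRate θ ^ 2 - 1)) := by
    funext θ; rw [axisCov_eq]; rfl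
  rw [h]
  have hc : Continuous (coshRate : (Fin m → ℝ) → ℝ) := by unfold coshRate energy; fun_prop
  refine (continuous_plaqNum D).measurable.mul
    ((Continuous.measurable ?_).div (Continuous.measurable ?_))
  · exact continuous_const.mul ((continuous_decayRatio.comp hc).pow n)
  · exact ((hc.pow 2).sub continuous_const).sqrt

/-! ### The Maxwell plaquette covariance -/

/-- The spatial Brillouin zone `[-π, π]^m`. -/
def cube (m : ℕ) : Set (Fin m → ℝ) := Set.pi Set.univ fun _ => Set.Icc (-π) π

/-- `vol (cube m) = (2π)^m`. -/
theorem volume_cube (m : ℕ) : volume (cube m) = ENNReal.ofReal (2 * π) ^ m := by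
  unfold cube
  rw [volume_pi_pi]
  simp only [Real.volume_Icc, Finset.prod_const, Finset.card_univ, Fintype.card_fin]
  congr 1; ring_nf

/-- **The lattice Maxwell plaquette covariance** at separation `n` along a lattice axis, for a
plaquette with (spatial) directions `D`, in `d = m + 1` dimensions:
`κ(n) = (2π)^{-(m+1)} ∫_{[-π,π]^m} ∫_{-π}^{π} N_D(θ) cos(n t) / (E(θ) + ŝ(t)) dt dθ`. -/
def maxwellCov (m : ℕ) (D : Finset (Fin m)) (n : ℕ) : ℝ :=
  ((2 * π) ^ (m + 1))⁻¹ * ∫ θ in cube m, axisCov D n θ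

/-- `axisCov D n` is integrable on the Brillouin zone (bounded and measurable). -/
theorem integrableOn_axisCov (D : Finset (Fin m)) (n : ℕ) :
    IntegrableOn (axisCov D n) (cube m) volume := by
  refine Measure.integrableOn_of_bounded (M := 2 * π) ?_
    (measurable_axisCov D n).aestronglyMeasurable (ae_of_all _ fun θ => ?_)
  · rw [volume_cube]; exact ENNReal.pow_ne_top ENNReal.ofReal_ne_top
  · rw [Real.norm_eq_abs, abs_of_nonneg (axisCov_nonneg D n θ)]
    exact axisCov_le_two_pi D n θ

/-- **Box lower bound.**  For `0 < δ ≤ π` and `D` non-empty, restricting the momentum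
integral to the box `[δ/2, δ]^m` (where `N_D ≥ ŝ(δ/2)` and `a ≤ 1 + m ŝ(δ)/2`):
`(2π)^{-(m+1)} · ŝ(δ/2) · axisKernel n (1 + m ŝ(δ)/2) · (δ/2)^m ≤ κ(n)`. -/
theorem maxwellCov_ge {D : Finset (Fin m)} (hD : D.Nonempty) {δ : ℝ} (hδ : 0 < δ)
    (hδπ : δ ≤ π) (n : ℕ) :
    ((2 * π) ^ (m + 1))⁻¹ * (sHat (δ / 2) * axisKernel n (1 + m * sHat δ / 2) * (δ / 2) ^ m)
      ≤ maxwellCov m D n := by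
  obtain ⟨j₀, hj₀⟩ := hD
  set B : Set (Fin m → ℝ) := Set.pi Set.univ fun _ => Set.Icc (δ / 2) δ with hB
  have hBmeas : MeasurableSet B := MeasurableSet.univ_pi fun _ => measurableSet_Icc
  have hBvol : volume B = ENNReal.ofReal (δ / 2) ^ m := by
    rw [hB, volume_pi_pi]
    simp only [Real.volume_Icc, Finset.prod_const, Finset.card_univ, Fintype.card_fin]
    congr 1; ring_nf
  have hBreal : volume.real B = (δ / 2) ^ m := by
    rw [measureReal_def, hBvol, ENNReal.toReal_pow, ENNReal.toReal_ofReal (by positivity)]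
  have hBsub : B ⊆ cube m := fun θ hθ => by
    simp only [hB, cube, Set.mem_pi, Set.mem_univ, true_implies, Set.mem_Icc] at hθ ⊢
    exact fun j => ⟨by linarith [(hθ j).1], (hθ j).2.trans hδπ⟩
  -- pointwise lower bound on the box
  have hδ2 : 0 < sHat (δ / 2) := sHat_pos (by linarith) (by linarith)
  have hma : 1 ≤ 1 + (m : ℝ) * sHat δ / 2 :=
    le_add_of_nonneg_right (by have := sHat_nonneg δ; positivity)
  have hpt : ∀ θ ∈ B,
      sHat (δ / 2) * axisKernel n (1 + m * sHat δ / 2) ≤ axisCov D n θ := by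
    intro θ hθ
    simp only [hB, Set.mem_pi, Set.mem_univ, true_implies, Set.mem_Icc] at hθ
    have hlo : ∀ j, sHat (δ / 2) ≤ sHat (θ j) := fun j =>
      sHat_mono (by linarith) (hθ j).1 (by linarith [(hθ j).2])
    have hhi : ∀ j, sHat (θ j) ≤ sHat δ := fun j =>
      sHat_mono (by linarith [(hθ j).1]) (hθ j).2 hδπ
    have hN : sHat (δ / 2) ≤ plaqNum D θ :=
      (hlo j₀).trans (Finset.single_le_sum (f := fun j => sHat (θ j))
        (fun j _ => sHat_nonneg (θ j)) hj₀)
    have hE : energy θ ≤ m * sHat δ := by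
      calc energy θ = ∑ j, sHat (θ j) := rfl
        _ ≤ ∑ _j : Fin m, sHat δ := Finset.sum_le_sum fun j _ => hhi j
        _ = m * sHat δ := by simp
    have ha : 1 < coshRate θ := by
      unfold coshRate
      linarith [hN.trans (plaqNum_le_energy D θ)]
    have hab : coshRate θ ≤ 1 + m * sHat δ / 2 := by unfold coshRate; linarith
    rw [axisCov_eq]
    exact mul_le_mul hN (axisKernel_antitone n ha hab) (axisKernel_nonneg n hma)
      (plaqNum_nonneg D θ)
  -- integrate
  have hint : sHat (δ / 2) * axisKernel n (1 + m * sHat δ / 2) * (δ / 2) ^ m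
      ≤ ∫ θ in B, axisCov D n θ := by
    rw [← hBreal]
    refine setIntegral_ge_of_const_le_real hBmeas ?_ hpt
      ((integrableOn_axisCov D n).mono_set hBsub)
    rw [hBvol]; exact ENNReal.pow_ne_top ENNReal.ofReal_ne_top
  have hmono : ∫ θ in B, axisCov D n θ ≤ ∫ θ in cube m, axisCov D n θ :=
    setIntegral_mono_set (integrableOn_axisCov D n)
      (ae_of_all _ fun θ => axisCov_nonneg D n θ) hBsub.eventuallyLE
  unfold maxwellCov
  exact mul_le_mul_of_nonneg_left (hint.trans hmono) (by positivity)

/-- The decay rates accumulate at zero (massless photon): for every `ε > 0` there is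
`δ ∈ (0, π]` with `e^{-ε} ≤ r(1 + m ŝ(δ)/2)`. -/
theorem exists_delta (m : ℕ) {ε : ℝ} (hε : 0 < ε) :
    ∃ δ : ℝ, 0 < δ ∧ δ ≤ π ∧ Real.exp (-ε) ≤ decayRatio (1 + m * sHat δ / 2) := by
  have hg : Continuous fun δ : ℝ => decayRatio (1 + m * sHat δ / 2) :=
    continuous_decayRatio.comp (by fun_prop)
  have h0 : Real.exp (-ε) < decayRatio (1 + m * sHat 0 / 2) := by
    rw [sHat_zero, mul_zero, zero_div, add_zero, decayRatio_one]
    exact Real.exp_lt_one_iff.2 (by linarith)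
  have hev : ∀ᶠ δ : ℝ in 𝓝 0, Real.exp (-ε) < decayRatio (1 + m * sHat δ / 2) :=
    continuousAt_const.eventually_lt hg.continuousAt h0
  obtain ⟨ρ, hρ, hball⟩ := Metric.eventually_nhds_iff.1 hev
  refine ⟨min (ρ / 2) π, lt_min (by positivity) pi_pos, min_le_right _ _, le_of_lt (hball ?_)⟩
  rw [dist_zero_right, Real.norm_eq_abs, abs_of_pos (lt_min (by positivity) pi_pos)]
  exact (min_le_left _ _).trans_lt (by linarith)

/-- **Main estimate (massless photon ⇒ no exponential decay).**  For `D` non-empty and every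
`ε > 0` there is `c > 0` with `c · e^{-ε n} ≤ κ(n)` for all `n`. -/
theorem exists_exp_mul_le_maxwellCov {D : Finset (Fin m)} (hD : D.Nonempty) {ε : ℝ}
    (hε : 0 < ε) : ∃ c : ℝ, 0 < c ∧ ∀ n : ℕ, c * Real.exp (-(ε * n)) ≤ maxwellCov m D n := by
  obtain ⟨δ, hδ, hδπ, hq⟩ := exists_delta m hε
  obtain ⟨j₀, _⟩ := hD
  have hm : (1 : ℝ) ≤ m := by exact_mod_cast Nat.succ_le_of_lt (Fin.pos j₀)
  have hsδ : 0 < sHat δ := sHat_pos hδ hδπ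
  have ha : 1 < 1 + (m : ℝ) * sHat δ / 2 := by nlinarith
  have hs : 0 < Real.sqrt ((1 + (m : ℝ) * sHat δ / 2) ^ 2 - 1) := Real.sqrt_pos.2 (by nlinarith)
  have hδ2 : 0 < sHat (δ / 2) := sHat_pos (by linarith) (by linarith)
  refine ⟨((2 * π) ^ (m + 1))⁻¹ *
      (sHat (δ / 2) * (π / Real.sqrt ((1 + (m : ℝ) * sHat δ / 2) ^ 2 - 1)) * (δ / 2) ^ m),
    by positivity, fun n => ?_⟩
  have hexp : Real.exp (-(ε * n)) = Real.exp (-ε) ^ n := by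
    rw [← Real.exp_nat_mul]; congr 1; ring
  have hK : π * Real.exp (-ε) ^ n / Real.sqrt ((1 + (m : ℝ) * sHat δ / 2) ^ 2 - 1)
      ≤ axisKernel n (1 + m * sHat δ / 2) :=
    axisKernel_ge_of_le_decayRatio n ha (Real.exp_pos _).le hq
  calc ((2 * π) ^ (m + 1))⁻¹ *
        (sHat (δ / 2) * (π / Real.sqrt ((1 + (m : ℝ) * sHat δ / 2) ^ 2 - 1)) * (δ / 2) ^ m) *
        Real.exp (-(ε * n))
      = ((2 * π) ^ (m + 1))⁻¹ * (sHat (δ / 2) *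
          (π * Real.exp (-ε) ^ n / Real.sqrt ((1 + (m : ℝ) * sHat δ / 2) ^ 2 - 1)) *
          (δ / 2) ^ m) := by rw [hexp]; ring
    _ ≤ ((2 * π) ^ (m + 1))⁻¹ *
          (sHat (δ / 2) * axisKernel n (1 + m * sHat δ / 2) * (δ / 2) ^ m) :=
        mul_le_mul_of_nonneg_left (mul_le_mul_of_nonneg_right
          (mul_le_mul_of_nonneg_left hK hδ2.le) (by positivity)) (by positivity)
    _ ≤ maxwellCov m D n := maxwellCov_ge ⟨j₀, ‹_›⟩ hδ hδπ n

/-- `κ(n) > 0` for every `n` (`D` non-empty). -/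
theorem maxwellCov_pos {D : Finset (Fin m)} (hD : D.Nonempty) (n : ℕ) : 0 < maxwellCov m D n := by
  obtain ⟨c, hc, h⟩ := exists_exp_mul_le_maxwellCov hD one_pos
  exact (mul_pos hc (Real.exp_pos _)).trans_le (h n)

/-- **The D13 hypothesis for `K n = C κ(n)²`.**  For `D` non-empty, `C > 0` and every rate
`m₀ > 0` there is `n` with `e^{-m₀ n} · C κ(0)² < C κ(n)²`. -/
theorem exists_exp_mul_maxwellCov_sq_lt {D : Finset (Fin m)} (hD : D.Nonempty) {C : ℝ}
    (hC : 0 < C) {m₀ : ℝ} (hm₀ : 0 < m₀) :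
    ∃ n : ℕ, Real.exp (-(m₀ * n)) * (C * maxwellCov m D 0 ^ 2) < C * maxwellCov m D n ^ 2 := by
  obtain ⟨c, hc, h⟩ := exists_exp_mul_le_maxwellCov hD (show 0 < m₀ / 4 by positivity)
  have hlim : Tendsto (fun n : ℕ => Real.exp (-(m₀ / 2 * n)) * maxwellCov m D 0 ^ 2)
      atTop (𝓝 0) := by
    have h1 : Tendsto (fun n : ℕ => -(m₀ / 2 * (n : ℝ))) atTop atBot :=
      tendsto_neg_atTop_atBot.comp
        (tendsto_natCast_atTop_atTop.const_mul_atTop (by positivity))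
    simpa using (Real.tendsto_exp_atBot.comp h1).mul_const (maxwellCov m D 0 ^ 2)
  obtain ⟨n, hn⟩ := (hlim.eventually (gt_mem_nhds (sq_pos_of_pos hc))).exists
  refine ⟨n, ?_⟩
  have hsq : (c * Real.exp (-(m₀ / 4 * n))) ^ 2 ≤ maxwellCov m D n ^ 2 :=
    pow_le_pow_left₀ (by positivity) (h n) 2
  have he2 : Real.exp (-(m₀ / 4 * n)) ^ 2 = Real.exp (-(m₀ / 2 * n)) := by
    rw [sq, ← Real.exp_add]; congr 1; ring
  have he1 : Real.exp (-(m₀ * n)) = Real.exp (-(m₀ / 2 * n)) * Real.exp (-(m₀ / 2 * n)) := by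
    rw [← Real.exp_add]; congr 1; ring
  have hpos : 0 < C * Real.exp (-(m₀ / 2 * n)) := by positivity
  calc Real.exp (-(m₀ * n)) * (C * maxwellCov m D 0 ^ 2)
      = C * Real.exp (-(m₀ / 2 * n)) * (Real.exp (-(m₀ / 2 * n)) * maxwellCov m D 0 ^ 2) := by
        rw [he1]; ring
    _ < C * Real.exp (-(m₀ / 2 * n)) * c ^ 2 := mul_lt_mul_of_pos_left hn hpos
    _ = C * (c * Real.exp (-(m₀ / 4 * n))) ^ 2 := by rw [mul_pow, he2]; ring
    _ ≤ C * maxwellCov m D n ^ 2 := mul_le_mul_of_nonneg_left hsq hC.le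

/-! ### Summit-side corollary: IR-0 for the Wilson plaquette field with Theorem A as the
only hypothesis -/

section Summit

variable {G : Type} [Group G] [TopologicalSpace G] [IsTopologicalGroup G] [CompactSpace G]
  [MeasurableSpace G] [BorelSpace G] [SecondCountableTopology G]

/-- **IR-0 for the Wilson plaquette field from Theorem A alone.**  For `G` simple compact, any
lattice representation `r`, spatial directions `i, j ≠ 0`, `i ≠ j`, the plaquette field
`P = plaquetteObservable r.ρ _ i j`, a scaling `s` eventually positive, `C > 0`, and a
non-empty set `D` of spatial directions in `m` spatial dimensions: if
`s β · c_{P,P}(n)` converges (torus-uniformly, `HasScaledCovarianceLimit`) to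
`C · κ(n)²` with `κ = maxwellCov m D` the lattice Maxwell plaquette covariance, then
`CorrelationLengthDiverges r P` — no `β`-uniform torus-uniform clustering rate at weak
coupling (and along any sequence `β_k → ∞`, by `Tendsto.eventually`).  (Theorem A of the
paper: `s β = β²`, `m = 3`, `D` = the two directions of the plaquette, `C = N²/2`.) -/
theorem correlationLengthDiverges_wilsonPlaquette_of_maxwellCovarianceLimit
    (hG : IsSimpleCompactGroup G) (r : LatticeRep G) {i j : Fin 4} (hi : i ≠ 0) (hj : j ≠ 0)
    (hij : i ≠ j) {s : ℝ → ℝ} (hs : ∀ᶠ β : ℝ in atTop, 0 < s β) {C : ℝ} (hC : 0 < C)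
    {m : ℕ} {D : Finset (Fin m)} (hD : D.Nonempty)
    (hlim : HasScaledCovarianceLimit r (plaquetteObservable r.ρ r.continuous i j) s
      (fun n => C * maxwellCov m D n ^ 2)) :
    CorrelationLengthDiverges r (plaquetteObservable r.ρ r.continuous i j) :=
  correlationLengthDiverges_wilsonPlaquette_of_ratioBound hG r hi hj hij
    (hasGaussianRatioBound_of_scaledCovarianceLimit r _ hlim hs
      (mul_pos hC (pow_pos (maxwellCov_pos hD 0) 2))
      fun _ hm₀ => exists_exp_mul_maxwellCov_sq_lt hD hC hm₀)

end Summit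

end Summit.QuantumFields.YangMills.Theorems.SoloBlind

end
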